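import Summits.BirchSwinnertonDyer.BirchSwinnertonDyer.Theorems.ClassRecordThreeEulerHalvesAtThreeCartanTransportResidueMaps
import Literature.NumberTheory.Automorphic.ShimuraCurveIdealsPrincipal
import Literature.NumberTheory.Automorphic.BrandtModuleSplitLocal
import HarnessLib

/-!
# Cartan transport, brick S — norm-one hull elements with prescribed residues

Route `ClassRecordThree`, crux `EulerHalvesAtThree` (stmt-19109) ∕ residue crux 23422, line `cartan`, node NUM ⟺ (F2b♮);
workfile `Cruxes/EulerHalvesAtThree/TRANSPORT-HULL.md` (road HT, brick S). Helper file, definition-free.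

For a Cartan datum `X : CartanLevelCurveData D M C` (hull `O₀` = Eichler order of level `M` in the indefinite
quaternion algebra `X.B` of discriminant `D`), residue models `ψ_q : O₀ → M₂(𝔽_q)` at the primes `q ∈ C`
(brick H1 `Residue.exists_isMatrixResidueMap_of_mem` supplies them) and targets `w_q ∈ M₂(𝔽_q)` of determinant `1`
at the ODD primes `q ∈ C`, there is `u ∈ O₀` with `nrd u = 1` and `ψ_q(u) = ± w_q` for every odd `q ∈ C`
(`exists_normOne_residues`). At `q = 2` no prescription is needed downstream: `M₂(𝔽₂)` contains a single copy
of `𝔽₄`, so any unit normalises it.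

PROOF. Eichler's norm theorem with congruence conditions, in the lattice form already in the tree
(`QuaternionAlgebra.exists_mem_mul_star_eq_one`: an indefinite `ℍ[ℚ,a,b]`, a full `ℤ`-lattice `Λ` with a local point of
norm `≡ 1 (mod 8p)` at every prime `p` has a point of norm one), applied — after transport to an integral model
`X.B ≃ ℍ[ℚ,a,b]` exactly as in `ShimuraCurveData.exists_eq_units_smul_of_pos` — to the residue-line lattice
`Λ = {x ∈ O₀ : ψ_q(x) ∈ 𝔽_q · w_q for all odd q ∈ C}` (`exists_lineLattice`; full since `N·O₀ ⊆ Λ ⊆ O₀`,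
`N = ∏ odd q ∈ C`). Local points: at an odd `q ∈ C`, `z = (N/q)·x` with `ψ_q(x) = (N/q)⁻¹ w_q` has `ψ_q(z) = w_q`,
`ψ_{q'}(z) = 0` at the other odd `q' ∈ C`, and `nrd z ≡ det w_q = 1 (mod q)` by the determinant clause of brick H1
(`Residue.trace_det`), i.e. `nrd z = 1 + 8·(qk/8)` with `|qk/8|_q < 1`; at every other prime (this includes `p ∣ DM` and
`p = 2`), `z = 1 ∈ Λ₍ₚ₎` because `N·1 ∈ Λ` with `p ∤ N`. A norm-one `u ∈ Λ` then has `ψ_q(u) = c_q w_q` with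
`c_q² = det ψ_q(u) = nrd u = 1 (mod q)`, so `c_q = ±1`.

USE (brick A of the memo; LEAD tam3-p1 g26 D1): with brick F (`ResidueField.exists_det_one_conj_field`: residue fields
`𝔽_q[η], 𝔽_q[η'] ⊂ M₂(𝔽_q)` are conjugate by a determinant-one matrix `w_q`) and brick H2 (a Cartan order inside its hull is
pinned by its residue fields), the unit `u` conjugates one Cartan order of the hull onto another with the same index data.
HONEST FRAMING: arithmetic of quaternion orders only; nothing about NUM, crux 23422 ∕ 19109 or any summit statement is
proved by this seat; BSD is proved for no curve. [cite: VignerasLNM800, Ch. III §4 Thm. 4.3 and §5 Cor. 5.7]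
-/

set_option linter.dupNamespace false
set_option autoImplicit false

noncomputable section

open scoped TensorProduct NumberField Pointwise Quaternion

namespace Summit.BirchSwinnertonDyer.BirchSwinnertonDyer.Theorems.CartanTransport.NormOneLift

open Literature.NumberTheory.Automorphic
open Summit.BirchSwinnertonDyer.BirchSwinnertonDyer.Theorems.CartanTransport

variable {D M : ℕ} {C : Finset ℕ}

/-- PROVED — **the residue-line lattice**: for residue models `ψ_q` (`q ∈ C`) of the hull and matrices `w_q`, the set
`Λ = {x ∈ O₀ : ψ_q(x) ∈ 𝔽_q · w_q for every odd q ∈ C}` is a `ℤ`-submodule of `X.B`. [folklore] -/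
theorem exists_lineLattice (X : CartanLevelCurveData D M C)
    (ψ : (q : ℕ) → X.B → Matrix (Fin 2) (Fin 2) (ZMod q))
    (hψ : ∀ q (hq : q ∈ C), haveI : Fact q.Prime := ⟨(X.coprime q hq).1⟩; IsMatrixResidueMap X.O₀ q (ψ q))
    (w : (q : ℕ) → Matrix (Fin 2) (Fin 2) (ZMod q)) :
    ∃ Λ : Submodule ℤ X.B, ∀ x, x ∈ Λ ↔
      (x ∈ X.O₀ ∧ ∀ q (hq : q ∈ C), q ≠ 2 → ∃ c : ZMod q, ψ q x = c • w q) := by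
  refine ⟨{ carrier := {x | x ∈ X.O₀ ∧ ∀ q (hq : q ∈ C), q ≠ 2 → ∃ c : ZMod q, ψ q x = c • w q}
            add_mem' := ?_, zero_mem' := ?_, smul_mem' := ?_ }, fun x => Iff.rfl⟩
  · rintro x y ⟨hx, hx'⟩ ⟨hy, hy'⟩
    refine ⟨X.O₀.add_mem hx hy, fun q hq hq2 => ?_⟩
    haveI : Fact q.Prime := ⟨(X.coprime q hq).1⟩
    obtain ⟨c, hc⟩ := hx' q hq hq2
    obtain ⟨c', hc'⟩ := hy' q hq hq2
    exact ⟨c + c', by rw [(hψ q hq).map_add x hx y hy, hc, hc', add_smul]⟩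
  · refine ⟨X.O₀.zero_mem, fun q hq _ => ?_⟩
    haveI : Fact q.Prime := ⟨(X.coprime q hq).1⟩
    exact ⟨0, by rw [(hψ q hq).map_zero, zero_smul]⟩
  · rintro n x ⟨hx, hx'⟩
    refine ⟨X.O₀.smul_mem n hx, fun q hq hq2 => ?_⟩
    haveI : Fact q.Prime := ⟨(X.coprime q hq).1⟩
    obtain ⟨c, hc⟩ := hx' q hq hq2
    exact ⟨(n : ZMod q) * c, by rw [(hψ q hq).map_zsmul hx n, hc, ← Int.cast_smul_eq_zsmul (ZMod q), smul_smul]⟩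

/-- PROVED — **norm-one hull elements with prescribed odd residues up to sign** (Eichler's norm theorem with congruence
conditions, lattice form): given residue models `ψ_q` of the hull `O₀` at the primes `q ∈ C` and targets `w_q` of
determinant `1` at the odd `q ∈ C`, some `u ∈ O₀` has `nrd u = 1` and `ψ_q(u) = w_q` or `ψ_q(u) = -w_q` for every odd
`q ∈ C`. [cite: VignerasLNM800, Ch. III §4 Thm. 4.3 and §5 Cor. 5.7] -/
theorem exists_normOne_residues (X : CartanLevelCurveData D M C)
    (ψ : (q : ℕ) → X.B → Matrix (Fin 2) (Fin 2) (ZMod q))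
    (hψ : ∀ q (hq : q ∈ C), haveI : Fact q.Prime := ⟨(X.coprime q hq).1⟩; IsMatrixResidueMap X.O₀ q (ψ q))
    (w : (q : ℕ) → Matrix (Fin 2) (Fin 2) (ZMod q)) (hw : ∀ q (hq : q ∈ C), q ≠ 2 → (w q).det = 1) :
    ∃ u ∈ X.O₀, reducedNorm ℚ X.B u = 1 ∧ ∀ q (hq : q ∈ C), q ≠ 2 → (ψ q u = w q ∨ ψ q u = -w q) := by
  classical
  obtain ⟨Λ, hΛ⟩ := exists_lineLattice X ψ hψ w
  have hO₀ : Brandt.IsOrder X.B X.O₀ := X.isEichlerOrder.isOrder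
  -- `N = ∏ odd q ∈ C`
  set C' : Finset ℕ := C.filter (· ≠ 2) with hC'
  have hC'mem : ∀ q, q ∈ C' ↔ q ∈ C ∧ q ≠ 2 := fun q => by rw [hC', Finset.mem_filter]
  have hprime : ∀ q ∈ C', q.Prime := fun q hq => (X.coprime q ((hC'mem q).mp hq).1).1
  set N : ℕ := ∏ q ∈ C', q with hN
  have hN0 : N ≠ 0 := Finset.prod_ne_zero_iff.mpr fun q hq => (hprime q hq).ne_zero
  have hΛle : Λ ≤ X.O₀ := fun x hx => ((hΛ x).mp hx).1
  -- `N · O₀ ⊆ Λ`, so `Λ` is a full lattice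
  have hNmem : ∀ x ∈ X.O₀, ((N : ℕ) : ℤ) • x ∈ Λ := by
    intro x hx
    refine (hΛ _).mpr ⟨X.O₀.smul_mem _ hx, fun q hq hq2 => ?_⟩
    haveI : Fact q.Prime := ⟨(X.coprime q hq).1⟩
    obtain ⟨m, hm⟩ : q ∣ N := Finset.dvd_prod_of_mem _ ((hC'mem q).mpr ⟨hq, hq2⟩)
    refine ⟨0, ?_⟩
    rw [zero_smul, hm, Nat.cast_mul, ← smul_smul, smul_comm, (hψ q hq).map_zsmul (X.O₀.smul_mem _ hx),
      (hψ q hq).map_smul_eq_zero hx, smul_zero]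
  have hΛfull : IsFullLattice X.B Λ :=
    isFullLattice_of_between hO₀.isFullLattice hΛle (m := ((N : ℕ) : ℤ)) (by exact_mod_cast hN0) hNmem
  -- an integral model `H = ℍ[ℚ,a,b]` of `X.B`
  obtain ⟨a, b, ha, hb, ⟨e⟩⟩ :=
    QuaternionAlgebra.exists_algEquiv_quaternionAlgebra_integers (K := ℚ) (D := X.B)
  have hinjO := FaithfulSMul.algebraMap_injective (𝓞 ℚ) ℚ
  haveI : IsQuaternionAlgebra ℚ ℍ[ℚ,algebraMap (𝓞 ℚ) ℚ a,algebraMap (𝓞 ℚ) ℚ b] :=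
    QuaternionAlgebra.isQuaternionAlgebra_holds ((map_ne_zero_iff _ hinjO).mpr ha)
      ((map_ne_zero_iff _ hinjO).mpr hb)
  set ΛH : Submodule ℤ ℍ[ℚ,algebraMap (𝓞 ℚ) ℚ a,algebraMap (𝓞 ℚ) ℚ b] :=
    Λ.map (e.toRingEquiv.toAddEquiv.toIntLinearEquiv :
      X.B →ₗ[ℤ] ℍ[ℚ,algebraMap (𝓞 ℚ) ℚ a,algebraMap (𝓞 ℚ) ℚ b]) with hΛH
  have hΛHfull : IsFullLattice _ ΛH := hΛfull.map_ringEquiv e.toRingEquiv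
  have hdef : ¬ IsTotallyDefinite ℚ ℍ[ℚ,algebraMap (𝓞 ℚ) ℚ a,algebraMap (𝓞 ℚ) ℚ b] := by
    obtain ⟨v⟩ : Nonempty (NumberField.InfinitePlace ℚ) := inferInstance
    exact fun h => h v (isSplitAtInfinite_of_algHom_real
      (X.ι.comp (e.symm : ℍ[ℚ,algebraMap (𝓞 ℚ) ℚ a,algebraMap (𝓞 ℚ) ℚ b] →ₐ[ℚ] X.B)) v)
  have hmemH : ∀ z : X.B, e z ∈ ΛH ↔ z ∈ Λ := fun z => by
    rw [hΛH, mem_map_ringEquiv_iff]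
    change e.symm (e z) ∈ Λ ↔ z ∈ Λ
    rw [e.symm_apply_apply]
  -- local points of norm `≡ 1 (mod 8p)`
  have hloc : ∀ p : ℕ, p.Prime → ∃ z ∈ localAt p ΛH, ∃ d : ℚ, padicNorm p d < 1 ∧
      z * star z = algebraMap ℚ _ (1 + 8 * d) := by
    intro p hp
    haveI : Fact p.Prime := ⟨hp⟩
    by_cases hpC : p ∈ C ∧ p ≠ 2
    · obtain ⟨hpC, hp2⟩ := hpC
      -- `z ∈ Λ` with `ψ_p(z) = w_p`
      set N₁ : ℕ := ∏ q ∈ C'.erase p, q with hN₁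
      have hpN₁ : ¬ p ∣ N₁ := by
        rw [hN₁, Prime.dvd_finsetProd_iff hp.prime]
        rintro ⟨q, hq, hpq⟩
        obtain ⟨hqp, hqC'⟩ := Finset.mem_erase.mp hq
        exact hqp ((Nat.prime_dvd_prime_iff_eq hp (hprime q hqC')).mp hpq).symm
      have hN₁u : ((N₁ : ℕ) : ZMod p) ≠ 0 := by
        rwa [Ne, ZMod.natCast_eq_zero_iff]
      obtain ⟨x, hx, hψx⟩ := (hψ p hpC).surj (((N₁ : ℕ) : ZMod p)⁻¹ • w p)
      set z : X.B := ((N₁ : ℕ) : ℤ) • x with hz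
      have hzO : z ∈ X.O₀ := X.O₀.smul_mem _ hx
      have hψz : ψ p z = w p := by
        rw [hz, (hψ p hpC).map_zsmul hx, hψx, ← Int.cast_smul_eq_zsmul (ZMod p), smul_smul, Int.cast_natCast,
          mul_inv_cancel₀ hN₁u, one_smul]
      have hzΛ : z ∈ Λ := by
        refine (hΛ z).mpr ⟨hzO, fun q hq hq2 => ?_⟩
        by_cases hqp : q = p
        · subst hqp
          exact ⟨1, by rw [one_smul, hψz]⟩
        · haveI : Fact q.Prime := ⟨(X.coprime q hq).1⟩
          obtain ⟨m, hm⟩ : q ∣ N₁ :=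
            Finset.dvd_prod_of_mem _ (Finset.mem_erase.mpr ⟨hqp, (hC'mem q).mpr ⟨hq, hq2⟩⟩)
          refine ⟨0, ?_⟩
          rw [zero_smul, hz, hm, Nat.cast_mul, ← smul_smul, smul_comm, (hψ q hq).map_zsmul (X.O₀.smul_mem _ hx),
            (hψ q hq).map_smul_eq_zero hx, smul_zero]
      -- `nrd z ≡ det w_p = 1 (mod p)`
      obtain ⟨t, n, -, hn, -, hdet⟩ := Residue.trace_det (hψ p hpC) hO₀ hzO
      have hn1 : ((n - 1 : ℤ) : ZMod p) = 0 := by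
        rw [Int.cast_sub, Int.cast_one, ← hdet, hψz, hw p hpC hp2, sub_self]
      obtain ⟨k, hk⟩ := (ZMod.intCast_zmod_eq_zero_iff_dvd (n - 1) p).mp hn1
      have hnk : (n : ℚ) = 1 + (p : ℚ) * k := by
        have : n = 1 + (p : ℤ) * k := by linarith
        exact_mod_cast this
      have h8 : ¬ p ∣ 8 := fun h8 =>
        hp2 ((Nat.prime_dvd_prime_iff_eq hp Nat.prime_two).mp (hp.dvd_of_dvd_pow (show p ∣ 2 ^ 3 from h8)))
      have h8' : padicNorm p (8 : ℚ) = 1 := by exact_mod_cast (padicNorm.nat_eq_one_iff (p := p) 8).mpr h8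
      refine ⟨e z, le_localAt p ΛH ((hmemH z).mpr hzΛ), (p : ℚ) * k / 8, ?_, ?_⟩
      · calc padicNorm p ((p : ℚ) * k / 8) = (p : ℚ)⁻¹ * padicNorm p (k : ℚ) := by
              rw [padicNorm.div, padicNorm.mul, h8', div_one, padicNorm.padicNorm_p_of_prime]
          _ ≤ (p : ℚ)⁻¹ * 1 := by gcongr; exact padicNorm.of_int k
          _ < 1 := by rw [mul_one]; exact inv_lt_one_of_one_lt₀ (by exact_mod_cast hp.one_lt)
      · rw [QuaternionAlgebra.mul_star_self_eq_algebraMap_reducedNorm ℚ (e z), reducedNorm_algEquiv e z, hn, hnk]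
        congr 1
        ring
    · -- `z = 1`, in `Λ₍ₚ₎` since `N · 1 ∈ Λ` with `p ∤ N`
      refine ⟨1, mem_localAt_iff.mpr ⟨N, hN0, ?_, ?_⟩, 0, by simp, by simp⟩
      · rw [hN]
        exact Nat.Coprime.prod_left fun q hq => (Nat.coprime_primes (hprime q hq) hp).mpr fun hqp =>
          hpC ⟨hqp ▸ ((hC'mem q).mp hq).1, hqp ▸ ((hC'mem q).mp hq).2⟩
      · have h1 := (hmemH _).mpr (hNmem 1 hO₀.one_mem)
        rwa [map_zsmul, map_one] at h1
  -- a norm-one point of `Λ`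
  obtain ⟨xH, hxΛ, hx1⟩ := QuaternionAlgebra.exists_mem_mul_star_eq_one a b ha hb hdef hΛHfull hloc
  set x : X.B := e.symm xH with hx
  have hxΛ' : x ∈ Λ := (mem_map_ringEquiv_iff e.toRingEquiv).mp hxΛ
  have hnx : reducedNorm ℚ X.B x = 1 := by
    have h := (QuaternionAlgebra.mul_star_self_eq_one_iff ℚ xH).mp hx1
    rwa [← e.apply_symm_apply xH, reducedNorm_algEquiv e] at h
  obtain ⟨hxO, hxres⟩ := (hΛ x).mp hxΛ'
  refine ⟨x, hxO, hnx, fun q hq hq2 => ?_⟩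
  haveI : Fact q.Prime := ⟨(X.coprime q hq).1⟩
  obtain ⟨c, hc⟩ := hxres q hq hq2
  have hdet := Residue.det_eq_one_of_reducedNorm_eq_one (hψ q hq) hO₀ hxO hnx
  rw [hc, Matrix.det_smul, hw q hq hq2, mul_one, Fintype.card_fin, sq, mul_self_eq_one_iff] at hdet
  rcases hdet with h1 | h1
  · exact Or.inl (by rw [hc, h1, one_smul])
  · exact Or.inr (by rw [hc, h1, neg_one_smul])

end Summit.BirchSwinnertonDyer.BirchSwinnertonDyer.Theorems.CartanTransport.NormOneLift
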